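import Summits.QuantumFields.BalabanUV.Beta.GAN24.DerivativeRateTransferJensenMassFreeKarcherEquation
import Summits.QuantumFields.BalabanUV.Beta.GAN24.DerivativeRateTransferJensenMassFreeKarcherGauss

/-!
# `BalabanUV.Beta.GAN24.DerivativeRateTransferJensenMassFreeFederbush` — binder row G-an2-4 ∕ (CONV-C), route R6 «VALUES, NOT DERIVATIVES», PART 80:
# FEDERBUSH's AVERAGE (1.27) IS THE KARCHER BASE (1.29), TYPED END TO END — the base `V` solving `Σ_x q_x•log(τ_xVᵀ) = 0` (PART 77) is the STRICT UNIQUE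
# MINIMISER of `d(W) = Σ_x q_x‖log(τ_xWᵀ)‖²` among orthogonal `W` with `‖WVᵀ − 1‖ ≤ 1∕100`: `d(V) + (6∕25)‖WVᵀ − 1‖² ≤ d(W)`; conversely at a base that does
# NOT solve (1.29) the half step `exp(½C̄)W` along the mean logarithm `C̄` DECREASES `d` by `(7∕10)‖C̄‖²`, so a minimising base solves (1.29) (Bałaban–Jaffe's
# (1.28) is the full first step `exp(C̄)·U(yy′)`); from transports with loop letter `D ≤ 1∕800` everything at once, with (1.26) within `1280D³ + 200704D⁴`
# of `V` (unit b2b-balaban-gan24-p3, gen 46; v1)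

NOT IN PRINT; OUR PROOF (for the ROUTE; PART 79 `half_normSq_log_expansion` summed with weights, PART 77 `karcher_base_of_transports`, PART 76 `exists_log_mul`, PART
69 `exists_skew_log_of_orthogonal`; [folklore] Karcher 1977 ∕ Kendall 1990 (uniqueness of Riemannian centres of mass in small balls) BY NAME).  HONEST FRAMING
(cell contract, verbatim): «discharging `BetaPertH` makes Bałaban's UV stability UNCONDITIONAL — a real constructive-QFT result; it is NOT the continuum limit and
NOT the Clay problem.»  HONEST DEPENDENCY (verbatim): «continuum YM on T⁴ ⇐ BetaPertH ∧ nine spine estimates (0/9 proved); BetaPertH ⇐ (D1) ∧ (D4) ∧ CAP+tail;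
G-an2-4 gates asym, D1 and NE2/3/4.»

WHY THIS FILE.  Bałaban–Jaffe [Erice 1985 p. 221, (1.27)]: «Define a real valued function `d` on the group element `V` by `d(V) = Σ_{x∈B(y)} dist²(U(Γ_x), V)`
(Federbush definition), where `dist(A,B)` denotes the geodesic distance from `A` to `B`.  Let `U(y,y′)` be a `V` which minimizes `d(V)`.  If the contour variables
`U(Γ_{yy′})` are close to each other, then `V` is uniquely defined.»  With `dist(U,V) = ‖log(UVᵀ)‖_F` (bi-invariant metric, small logarithm — BY NAME) and weights
`q_x` (`L^{−d}` in print): (§1) **`federbush_expansion`** — PART 79 summed: for skew logarithms `C_x` at a base (`‖C_x‖ ≤ 1∕100`), a skew step `E` (`‖E‖ ≤ 1∕50`)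
and the logarithms `C′_x = log(exp(C_x)exp E)` at the shifted base, `|Σq½‖C′‖² − Σq½‖C‖² − tr((Σq•C)ᵀE) − ½‖E‖²| ≤ 10(1∕100 + (3∕2)‖E‖)²‖E‖²`;
(§2) **`federbush_strict_min`** — at a KARCHER base `V` (`Σq•C = 0`) every orthogonal `W` with `‖WVᵀ − 1‖ ≤ 1∕100` and ANY small logarithms `C′` at `W`
(`exp(C′_x)W = τ_x`; they are `log(exp(C_x)exp E)` with `E = log(VWᵀ)`, `‖E‖ ≤ 1∕50`, `‖WVᵀ − 1‖ ≤ 2‖E‖`) satisfy `Σq‖C‖² + (6∕25)‖WVᵀ − 1‖² ≤ Σq‖C′‖²`;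
**`federbush_minimiser_unique`** — a `W` doing at least as well IS `V`; (§3) **`federbush_half_step`** — at ANY base `W` with skew logarithms `C_x` (`≤ 1∕100`)
and mean `C̄`, the logarithms `C″` at `W₂ = exp(½C̄)W` satisfy `Σq‖C″‖² + (7∕10)‖C̄‖² ≤ Σq‖C‖²` (the expansion with `E = −½C̄`: `tr(C̄ᵀE) = −½‖C̄‖²`);
**`federbush_min_is_karcher`** — minimal against that one competitor ⟹ `C̄ = 0`; `exists_logs_half_step` (the competitor's logarithms exist, PART 76);
(§4) **`federbush_of_transports`** — from the loop letter `D ≤ 1∕800` (so that PART 77's `8D ≤ 1∕100`): the Karcher base `V` with `Σq•C = 0`, `‖C_x‖ ≤ 8D`,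
its strict unique minimality on the ball `‖WVᵀ − 1‖ ≤ 1∕100`, and (1.26) within `1280D³ + 200704D⁴` of it — (1.27) = (1.29) = within third order of (1.26) and
(1.28) (PART 77 `exists_polar_near_karcher`).

HONEST SCOPE.  «Geodesic distance = Frobenius norm of the small logarithm» is BY NAME; minimality is proved on the ball `‖WVᵀ − 1‖ ≤ 1∕100` (outside it `d` is
not even defined by small logarithms); crude windows (`D ≤ 1∕800` = `p̂ ≤ 1∕(800·2d(L−1)L)` on the block lattice) and constants; full orthogonal group; ONE scale;
nothing of Bałaban's `Ū ∕ G_k ∕ Δ_k` instantiated; NOT the tower, NOT (CONS), NOT (CONV-C).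

WHAT THIS FILE PROVES (0 sorry, 0 `def`, nothing cited): §1 **`federbush_expansion`**; §2 `exp_log_at_base`, **`federbush_strict_min`**, **`federbush_minimiser_unique`**;
§3 **`federbush_half_step`**, **`federbush_min_is_karcher`**, `exists_logs_half_step`; §4 **`federbush_of_transports`**.
SUPPLIER work on route R6 (rank 2, REDUCTION, no seat); no consumer of record; NEVER «G-an2-4 closed»; NOT (CONV-C), NOT D1, NOT `BetaPertH`, NOT continuum,
NOT Clay.  Records: `HOME/b2b-balaban-gan24-p3/WOODBURY-FIBRE.md` v14.6, `HOME/beta/ROUTES-GAN24.md` v60 §3, `HOME/b2b-balaban-gan24-refuter/PRICING-GAN24.md`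
v3.59 (R6 row l.507). -/

noncomputable section

open scoped Matrix Matrix.Norms.Frobenius NNReal
open NormedSpace Finset Matrix Metric Set

namespace Summit.QuantumFields.BalabanUV.Beta.GAN24.DerivativeRateTransferJensenMassFreeFederbush

open Summit.QuantumFields.BalabanUV.Beta.GAN24.DerivativeRateTransferJensenMassFreePolarNear
open Summit.QuantumFields.BalabanUV.Beta.GAN24.DerivativeRateTransferJensenMassFreeExpTaylor
open Summit.QuantumFields.BalabanUV.Beta.GAN24.DerivativeRateTransferJensenMassFreeLogarithm
open Summit.QuantumFields.BalabanUV.Beta.GAN24.DerivativeRateTransferJensenMassFreeKarcherContraction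
open Summit.QuantumFields.BalabanUV.Beta.GAN24.DerivativeRateTransferJensenMassFreeKarcherEquation
open Summit.QuantumFields.BalabanUV.Beta.GAN24.DerivativeRateTransferJensenMassFreeKarcherGauss

variable {o ν : Type*} [Fintype o] [DecidableEq o] [Fintype ν]

/-! ## §1 Federbush's functional one step away from a base: the weighted expansion -/

/-- **`federbush_expansion` — THE WEIGHTED GAUSS EXPANSION** [our proof; PART 79 summed]: skew logarithms `C_x` at a base (`‖C_x‖ ≤ 1∕100`), a skew step `E`
(`‖E‖ ≤ 1∕50`), and the small logarithms `C′_x` of `exp(C_x)·exp(E)` (the logarithms at the shifted base) satisfy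
`|Σ_x q_x·½‖C′_x‖² − Σ_x q_x·½‖C_x‖² − tr((Σ_x q_x•C_x)ᵀE) − ½‖E‖²| ≤ 10(1∕100 + (3∕2)‖E‖)²‖E‖²`. -/
theorem federbush_expansion {q : ν → ℝ} (hq : ∀ x, 0 ≤ q x) (hq1 : ∑ x, q x = 1) {C C' : ν → Matrix o o ℝ} {E : Matrix o o ℝ}
    (hCt : ∀ x, (C x)ᵀ = -C x) (hC : ∀ x, ‖C x‖ ≤ 1 / 100) (hEt : Eᵀ = -E) (hE : ‖E‖ ≤ 1 / 50) (hC' : ∀ x, ‖C' x‖ ≤ 1 / 4)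
    (hC'e : ∀ x, exp (C' x) = exp (C x) * exp E) :
    |∑ x, q x * (1 / 2 * ‖C' x‖ ^ 2) - ∑ x, q x * (1 / 2 * ‖C x‖ ^ 2) - Matrix.trace ((∑ x, q x • C x)ᵀ * E) - 1 / 2 * ‖E‖ ^ 2| ≤
      10 * (1 / 100 + 3 / 2 * ‖E‖) ^ 2 * ‖E‖ ^ 2 := by
  set r : ν → ℝ := fun x => 1 / 2 * ‖C' x‖ ^ 2 - 1 / 2 * ‖C x‖ ^ 2 - Matrix.trace ((C x)ᵀ * E) - 1 / 2 * ‖E‖ ^ 2 with hr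
  have hrx : ∀ x, |r x| ≤ 10 * (1 / 100 + 3 / 2 * ‖E‖) ^ 2 * ‖E‖ ^ 2 := fun x => by
    refine (half_normSq_log_expansion (hCt x) hEt (hC x) hE (hC' x) (hC'e x)).trans ?_
    have h : (‖C x‖ + 3 / 2 * ‖E‖) ^ 2 ≤ (1 / 100 + 3 / 2 * ‖E‖) ^ 2 :=
      pow_le_pow_left₀ (by positivity) (by linarith [hC x]) 2
    nlinarith [sq_nonneg ‖E‖]
  have ht : Matrix.trace ((∑ x, q x • C x)ᵀ * E) = ∑ x, q x * Matrix.trace ((C x)ᵀ * E) := by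
    rw [transpose_sum, Finset.sum_mul, Matrix.trace_sum]
    refine Finset.sum_congr rfl fun x _ => ?_
    rw [transpose_smul, Matrix.smul_mul, Matrix.trace_smul, smul_eq_mul]
  have h1 : 1 / 2 * ‖E‖ ^ 2 = ∑ x, q x * (1 / 2 * ‖E‖ ^ 2) := by rw [← Finset.sum_mul, hq1, one_mul]
  have hsum : ∑ x, q x * (1 / 2 * ‖C' x‖ ^ 2) - ∑ x, q x * (1 / 2 * ‖C x‖ ^ 2) - Matrix.trace ((∑ x, q x • C x)ᵀ * E) - 1 / 2 * ‖E‖ ^ 2 =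
      ∑ x, q x * r x := by
    rw [ht, h1]
    simp only [hr, mul_sub, Finset.sum_sub_distrib]
  rw [hsum]
  refine (Finset.abs_sum_le_sum_abs _ _).trans ?_
  have e : ∀ x, |q x * r x| = q x * |r x| := fun x => by rw [abs_mul, abs_of_nonneg (hq x)]
  simp only [e]
  exact wsum_le_of_le hq hq1 hrx

/-! ## §2 The Karcher base is the strict, unique minimiser of Federbush's functional -/

omit [Fintype ν] in
/-- the logarithms at a second base: `exp(C′_x)·W = τ_x = exp(C_x)·V` ⟹ `exp(C′_x) = exp(C_x)·(V·Wᵀ)`. [folklore] -/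
theorem exp_log_at_base {C C' : Matrix o o ℝ} {V W τ : Matrix o o ℝ} (hW : Wᵀ * W = 1) (hCe : exp C * V = τ) (hC'e : exp C' * W = τ) :
    exp C' = exp C * (V * Wᵀ) := by
  have hWW : W * Wᵀ = 1 := mul_eq_one_comm.mp hW
  calc exp C' = exp C' * W * Wᵀ := by rw [Matrix.mul_assoc, hWW, Matrix.mul_one]
    _ = exp C * (V * Wᵀ) := by rw [hC'e, ← hCe, Matrix.mul_assoc]

/-- **`federbush_strict_min` — (1.27): THE KARCHER BASE MINIMISES `Σ_x q_x dist²(τ_x, ·)`, STRICTLY** [our proof]: `V` orthogonal with skew logarithms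
`exp(C_x)·V = τ_x`, `‖C_x‖ ≤ 1∕100`, `Σ_x q_x•C_x = 0` (the Karcher equation); `W` orthogonal with `‖W·Vᵀ − 1‖ ≤ 1∕100` and ANY small logarithms
`exp(C′_x)·W = τ_x` (`‖C′_x‖ ≤ 1∕4`) ⟹ `Σ_x q_x‖C_x‖² + (6∕25)‖W·Vᵀ − 1‖² ≤ Σ_x q_x‖C′_x‖²` (geodesic distance = Frobenius norm of the small logarithm). -/
theorem federbush_strict_min {q : ν → ℝ} (hq : ∀ x, 0 ≤ q x) (hq1 : ∑ x, q x = 1) {τ : ν → Matrix o o ℝ} {V W : Matrix o o ℝ}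
    (hV : Vᵀ * V = 1) (hW : Wᵀ * W = 1) {C C' : ν → Matrix o o ℝ} (hCt : ∀ x, (C x)ᵀ = -C x) (hC : ∀ x, ‖C x‖ ≤ 1 / 100)
    (hCe : ∀ x, exp (C x) * V = τ x) (h0 : ∑ x, q x • C x = 0) (hWV : ‖W * Vᵀ - 1‖ ≤ 1 / 100) (hC' : ∀ x, ‖C' x‖ ≤ 1 / 4)
    (hC'e : ∀ x, exp (C' x) * W = τ x) :
    ∑ x, q x * ‖C x‖ ^ 2 + 6 / 25 * ‖W * Vᵀ - 1‖ ^ 2 ≤ ∑ x, q x * ‖C' x‖ ^ 2 := by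
  have hV' : V * Vᵀ = 1 := mul_eq_one_comm.mp hV
  have hW' : W * Wᵀ = 1 := mul_eq_one_comm.mp hW
  -- the step `E = log(V·Wᵀ)`
  have horth : (V * Wᵀ)ᵀ * (V * Wᵀ) = 1 := by
    rw [transpose_mul, transpose_transpose, Matrix.mul_assoc, ← Matrix.mul_assoc Vᵀ, hV, Matrix.one_mul, hW']
  have hnorm : ‖V * Wᵀ - 1‖ = ‖W * Vᵀ - 1‖ := by
    rw [← Matrix.frobenius_norm_transpose (W * Vᵀ - 1), transpose_sub, transpose_mul, transpose_transpose, transpose_one]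
  obtain ⟨E, hEt, -, hE2, hEe⟩ := exists_skew_log_of_orthogonal horth (by rw [hnorm]; exact hWV.trans (by norm_num))
  have hE : ‖E‖ ≤ 1 / 50 := by rw [hnorm] at hE2; linarith
  have hC'E : ∀ x, exp (C' x) = exp (C x) * exp E := fun x => by rw [hEe]; exact exp_log_at_base hW (hCe x) (hC'e x)
  have hexp := federbush_expansion hq hq1 hCt hC hEt hE hC' hC'E
  rw [h0, transpose_zero, Matrix.zero_mul, Matrix.trace_zero, sub_zero] at hexp
  -- `‖W·Vᵀ − 1‖ ≤ 2‖E‖`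
  have hWE : ‖W * Vᵀ - 1‖ ≤ 2 * ‖E‖ := by
    rw [← hnorm, ← hEe]; exact norm_exp_sub_one_le E (hE.trans (by norm_num))
  have hsq : ‖W * Vᵀ - 1‖ ^ 2 ≤ 4 * ‖E‖ ^ 2 := by nlinarith [norm_nonneg (W * Vᵀ - 1)]
  have hcoef : 10 * (1 / 100 + 3 / 2 * ‖E‖) ^ 2 ≤ 2 / 125 := by nlinarith [norm_nonneg E]
  have h2 : ∑ x, q x * (1 / 2 * ‖C' x‖ ^ 2) = 1 / 2 * ∑ x, q x * ‖C' x‖ ^ 2 := by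
    rw [Finset.mul_sum]; exact Finset.sum_congr rfl fun x _ => by ring
  have h3 : ∑ x, q x * (1 / 2 * ‖C x‖ ^ 2) = 1 / 2 * ∑ x, q x * ‖C x‖ ^ 2 := by
    rw [Finset.mul_sum]; exact Finset.sum_congr rfl fun x _ => by ring
  rw [h2, h3] at hexp
  have habs := (abs_le.mp hexp).1
  nlinarith [sq_nonneg ‖E‖, mul_le_mul_of_nonneg_right hcoef (sq_nonneg ‖E‖)]

/-- **`federbush_minimiser_unique` — «IF THE CONTOUR VARIABLES ARE CLOSE TO EACH OTHER, THEN `V` IS UNIQUELY DEFINED»** [Bałaban–Jaffe, Erice 1985 p. 221,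
after (1.27); our proof with radii]: under the hypotheses of `federbush_strict_min`, if the base `W` does at least as well as `V`
(`Σ_x q_x‖C′_x‖² ≤ Σ_x q_x‖C_x‖²`) then `W = V`. -/
theorem federbush_minimiser_unique {q : ν → ℝ} (hq : ∀ x, 0 ≤ q x) (hq1 : ∑ x, q x = 1) {τ : ν → Matrix o o ℝ} {V W : Matrix o o ℝ}
    (hV : Vᵀ * V = 1) (hW : Wᵀ * W = 1) {C C' : ν → Matrix o o ℝ} (hCt : ∀ x, (C x)ᵀ = -C x) (hC : ∀ x, ‖C x‖ ≤ 1 / 100)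
    (hCe : ∀ x, exp (C x) * V = τ x) (h0 : ∑ x, q x • C x = 0) (hWV : ‖W * Vᵀ - 1‖ ≤ 1 / 100) (hC' : ∀ x, ‖C' x‖ ≤ 1 / 4)
    (hC'e : ∀ x, exp (C' x) * W = τ x) (hle : ∑ x, q x * ‖C' x‖ ^ 2 ≤ ∑ x, q x * ‖C x‖ ^ 2) : W = V := by
  have h := federbush_strict_min hq hq1 hV hW hCt hC hCe h0 hWV hC' hC'e
  have h2 : ‖W * Vᵀ - 1‖ ^ 2 ≤ 0 := by linarith
  have h3 : ‖W * Vᵀ - 1‖ = 0 := by nlinarith [norm_nonneg (W * Vᵀ - 1)]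
  have h4 : W * Vᵀ = 1 := sub_eq_zero.mp (norm_eq_zero.mp h3)
  calc W = W * Vᵀ * V := by rw [Matrix.mul_assoc, hV, Matrix.mul_one]
    _ = V := by rw [h4, Matrix.one_mul]

/-! ## §3 Away from the Karcher base the half step along the mean logarithm decreases the functional -/

/-- **`federbush_half_step` — A NON-KARCHER BASE IS NOT A MINIMISER** [our proof]: `W` orthogonal with skew logarithms `exp(C_x)·W = τ_x`, `‖C_x‖ ≤ 1∕100`,
mean `C̄ = Σ_x q_x•C_x`; the half-step base `W₂ = exp(½C̄)·W` (orthogonal) with ANY small logarithms `exp(C″_x)·W₂ = τ_x` (`‖C″_x‖ ≤ 1∕4`) satisfies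
`Σ_x q_x‖C″_x‖² + (7∕10)‖C̄‖² ≤ Σ_x q_x‖C_x‖²`.  Hence a base that is minimal against this one competitor solves the Karcher equation `C̄ = 0`
(`federbush_min_is_karcher`), and Bałaban–Jaffe's (1.28) = the FULL step `exp(C̄)·W` from `W = U(yy′)` is the first Picard iterate towards (1.29). -/
theorem federbush_half_step {q : ν → ℝ} (hq : ∀ x, 0 ≤ q x) (hq1 : ∑ x, q x = 1) {τ : ν → Matrix o o ℝ} {W : Matrix o o ℝ}
    (hW : Wᵀ * W = 1) {C C'' : ν → Matrix o o ℝ} (hCt : ∀ x, (C x)ᵀ = -C x) (hC : ∀ x, ‖C x‖ ≤ 1 / 100)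
    (hCe : ∀ x, exp (C x) * W = τ x) (hC'' : ∀ x, ‖C'' x‖ ≤ 1 / 4)
    (hC''e : ∀ x, exp (C'' x) * (exp ((1 / 2 : ℝ) • ∑ y, q y • C y) * W) = τ x) :
    ∑ x, q x * ‖C'' x‖ ^ 2 + 7 / 10 * ‖∑ x, q x • C x‖ ^ 2 ≤ ∑ x, q x * ‖C x‖ ^ 2 := by
  set Cb : Matrix o o ℝ := ∑ x, q x • C x with hCb
  have hCbt : Cbᵀ = -Cb := wsum_skew hCt
  have hCbn : ‖Cb‖ ≤ 1 / 100 := norm_wmean_le hq hq1 hC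
  set E : Matrix o o ℝ := -((1 / 2 : ℝ) • Cb) with hE
  have hEt : Eᵀ = -E := by rw [hE, transpose_neg, transpose_smul, hCbt, smul_neg]
  have hEn : ‖E‖ = 1 / 2 * ‖Cb‖ := by
    rw [hE, norm_neg, norm_smul, Real.norm_eq_abs, abs_of_pos (by norm_num : (0 : ℝ) < 1 / 2)]
  have hE50 : ‖E‖ ≤ 1 / 50 := by rw [hEn]; linarith
  have hhalf : ((1 / 2 : ℝ) • Cb)ᵀ = -((1 / 2 : ℝ) • Cb) := by rw [transpose_smul, hCbt, smul_neg]
  have hW₂ : (exp ((1 / 2 : ℝ) • Cb) * W)ᵀ * (exp ((1 / 2 : ℝ) • Cb) * W) = 1 := by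
    rw [transpose_mul, Matrix.mul_assoc, ← Matrix.mul_assoc (exp ((1 / 2 : ℝ) • Cb))ᵀ, orthogonal_exp_of_skew hhalf, Matrix.one_mul, hW]
  -- logarithms at the half-step base: `exp(C″_x) = exp(C_x)·exp(E)`
  have hC''E : ∀ x, exp (C'' x) = exp (C x) * exp E := fun x => by
    have h := exp_log_at_base hW₂ (hCe x) (hC''e x)
    rw [h, transpose_mul, transpose_exp_of_skew hhalf, ← Matrix.mul_assoc W, mul_eq_one_comm.mp hW, Matrix.one_mul]
  have hexp := federbush_expansion hq hq1 hCt hC hEt hE50 hC'' hC''E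
  -- `tr(C̄ᵀE) = −½‖C̄‖²`, `‖E‖² = ¼‖C̄‖²`
  have htr : Matrix.trace (Cbᵀ * E) = -(1 / 2) * ‖Cb‖ ^ 2 := by
    rw [hE, Matrix.mul_neg, Matrix.mul_smul, Matrix.trace_neg, Matrix.trace_smul, smul_eq_mul, trace_transpose_mul_self]; ring
  have hEsq : ‖E‖ ^ 2 = 1 / 4 * ‖Cb‖ ^ 2 := by rw [hEn]; ring
  have hcoef : 10 * (1 / 100 + 3 / 2 * ‖E‖) ^ 2 ≤ 1 / 250 := by rw [hEn]; nlinarith [norm_nonneg Cb]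
  have h2 : ∑ x, q x * (1 / 2 * ‖C'' x‖ ^ 2) = 1 / 2 * ∑ x, q x * ‖C'' x‖ ^ 2 := by
    rw [Finset.mul_sum]; exact Finset.sum_congr rfl fun x _ => by ring
  have h3 : ∑ x, q x * (1 / 2 * ‖C x‖ ^ 2) = 1 / 2 * ∑ x, q x * ‖C x‖ ^ 2 := by
    rw [Finset.mul_sum]; exact Finset.sum_congr rfl fun x _ => by ring
  rw [h2, h3, htr, hEsq] at hexp
  have habs := (abs_le.mp hexp).2
  nlinarith [sq_nonneg ‖Cb‖, mul_le_mul_of_nonneg_right hcoef (by positivity : (0 : ℝ) ≤ 1 / 4 * ‖Cb‖ ^ 2)]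

/-- **`federbush_min_is_karcher` — A MINIMISING BASE SOLVES (1.29)** [our proof]: under the hypotheses of `federbush_half_step`, if `W` does at least as well as
its half-step competitor (`Σ_x q_x‖C_x‖² ≤ Σ_x q_x‖C″_x‖²`) then `Σ_x q_x•C_x = 0`. -/
theorem federbush_min_is_karcher {q : ν → ℝ} (hq : ∀ x, 0 ≤ q x) (hq1 : ∑ x, q x = 1) {τ : ν → Matrix o o ℝ} {W : Matrix o o ℝ}
    (hW : Wᵀ * W = 1) {C C'' : ν → Matrix o o ℝ} (hCt : ∀ x, (C x)ᵀ = -C x) (hC : ∀ x, ‖C x‖ ≤ 1 / 100)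
    (hCe : ∀ x, exp (C x) * W = τ x) (hC'' : ∀ x, ‖C'' x‖ ≤ 1 / 4)
    (hC''e : ∀ x, exp (C'' x) * (exp ((1 / 2 : ℝ) • ∑ y, q y • C y) * W) = τ x)
    (hle : ∑ x, q x * ‖C x‖ ^ 2 ≤ ∑ x, q x * ‖C'' x‖ ^ 2) : ∑ x, q x • C x = 0 := by
  have h := federbush_half_step hq hq1 hW hCt hC hCe hC'' hC''e
  have h2 : ‖∑ x, q x • C x‖ ^ 2 ≤ 0 := by linarith
  have h3 : ‖∑ x, q x • C x‖ = 0 := by nlinarith [norm_nonneg (∑ x, q x • C x)]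
  exact norm_eq_zero.mp h3

/-- existence of the competitor's logarithms in `federbush_half_step` ∕ `federbush_min_is_karcher` (so that those hypotheses are never vacuous): the loops
`τ_x·W₂ᵀ = exp(C_x)·exp(−½C̄)` are within `1∕16` of `1`. [PART 76] -/
theorem exists_logs_half_step {q : ν → ℝ} (hq : ∀ x, 0 ≤ q x) (hq1 : ∑ x, q x = 1) {τ : ν → Matrix o o ℝ} {W : Matrix o o ℝ}
    {C : ν → Matrix o o ℝ} (hCt : ∀ x, (C x)ᵀ = -C x) (hC : ∀ x, ‖C x‖ ≤ 1 / 100) (hCe : ∀ x, exp (C x) * W = τ x) :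
    ∃ C'' : ν → Matrix o o ℝ, (∀ x, ‖C'' x‖ ≤ 1 / 4) ∧ ∀ x, exp (C'' x) * (exp ((1 / 2 : ℝ) • ∑ y, q y • C y) * W) = τ x := by
  set Cb : Matrix o o ℝ := ∑ x, q x • C x with hCb
  have hCbt : Cbᵀ = -Cb := wsum_skew hCt
  have hCbn : ‖Cb‖ ≤ 1 / 100 := norm_wmean_le hq hq1 hC
  have hB : ‖(1 / 2 : ℝ) • Cb‖ ≤ 1 / 50 := by
    rw [norm_smul, Real.norm_eq_abs, abs_of_pos (by norm_num : (0 : ℝ) < 1 / 2)]; linarith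
  have hhalf : ((1 / 2 : ℝ) • Cb)ᵀ = -((1 / 2 : ℝ) • Cb) := by rw [transpose_smul, hCbt, smul_neg]
  have h : ∀ x, ∃ Cx : Matrix o o ℝ, ‖Cx‖ ≤ 1 / 4 ∧ exp Cx = exp (C x) * exp (-((1 / 2 : ℝ) • Cb)) := fun x => exists_log_mul (hC x) hB
  choose C'' hC''4 hC''e using h
  refine ⟨C'', hC''4, fun x => ?_⟩
  have hC''e' : exp (C'' x) = exp (C x) * exp (-((1 / 2 : ℝ) • Cb)) := hC''e x
  rw [hC''e', ← transpose_exp_of_skew hhalf, Matrix.mul_assoc, ← Matrix.mul_assoc (exp ((1 / 2 : ℝ) • Cb))ᵀ, orthogonal_exp_of_skew hhalf,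
    Matrix.one_mul, hCe x]

/-! ## §4 From the transports: (1.27) typed end to end -/

/-- **`federbush_of_transports` — (1.27) PROPER, FROM THE LOOP LETTER** [our proof; PARTs 76–79]: weights `q ≥ 0`, `Σq = 1`, orthogonal transports `τ_x` and
reference `τ₀` with `‖τ_x·τ₀ᵀ − 1‖ ≤ D ≤ 1∕800` ⟹ there is an orthogonal base `V` (`‖V·τ₀ᵀ − 1‖ ≤ 8D`) with skew logarithms `exp(C_x)·V = τ_x`,
`‖C_x‖ ≤ 8D`, solving the KARCHER EQUATION `Σ_x q_x•C_x = 0`, which is the STRICT UNIQUE MINIMISER of Federbush's `d(W) = Σ_x q_x‖log(τ_xWᵀ)‖²` among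
orthogonal `W` with `‖W·Vᵀ − 1‖ ≤ 1∕100` (`d(V) + (6∕25)‖WVᵀ − 1‖² ≤ d(W)` for any choice of small logarithms at `W`), and EVERY polar link `R′` (1.26) of
`Σ_x q_x•τ_x` is within `1280D³ + 200704D⁴` of `V`. -/
theorem federbush_of_transports {q : ν → ℝ} (hq : ∀ x, 0 ≤ q x) (hq1 : ∑ x, q x = 1) {τ : ν → Matrix o o ℝ} {τ₀ : Matrix o o ℝ}
    (hτ : ∀ x, (τ x)ᵀ * τ x = 1) (hτ₀ : τ₀ᵀ * τ₀ = 1) {D : ℝ} (hD : ∀ x, ‖τ x * τ₀ᵀ - 1‖ ≤ D) (hD800 : D ≤ 1 / 800) :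
    ∃ (V : Matrix o o ℝ) (C : ν → Matrix o o ℝ), Vᵀ * V = 1 ∧ ‖V * τ₀ᵀ - 1‖ ≤ 8 * D ∧ (∀ x, (C x)ᵀ = -C x) ∧
      (∀ x, exp (C x) * V = τ x) ∧ (∀ x, ‖C x‖ ≤ 8 * D) ∧ ∑ x, q x • C x = 0 ∧
      (∀ (W : Matrix o o ℝ) (C' : ν → Matrix o o ℝ), Wᵀ * W = 1 → ‖W * Vᵀ - 1‖ ≤ 1 / 100 → (∀ x, ‖C' x‖ ≤ 1 / 4) →
        (∀ x, exp (C' x) * W = τ x) → ∑ x, q x * ‖C x‖ ^ 2 + 6 / 25 * ‖W * Vᵀ - 1‖ ^ 2 ≤ ∑ x, q x * ‖C' x‖ ^ 2) ∧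
      ∀ R' : Matrix o o ℝ, R'ᵀ * R' = 1 → ((∑ x, q x • τ x) * R'ᵀ)ᵀ = (∑ x, q x • τ x) * R'ᵀ →
        (∀ w : o → ℝ, 0 ≤ w ⬝ᵥ (((∑ x, q x • τ x) * R'ᵀ) *ᵥ w)) → ‖R' - V‖ ≤ 1280 * D ^ 3 + 200704 * D ^ 4 := by
  obtain ⟨V, C, hV, hV1, hCt, hCe, hC8, h0, hpol⟩ := karcher_base_of_transports hq hq1 hτ hτ₀ hD (by linarith)
  have hC : ∀ x, ‖C x‖ ≤ 1 / 100 := fun x => (hC8 x).trans (by linarith)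
  exact ⟨V, C, hV, hV1, hCt, hCe, hC8, h0, fun W C' hW hWV hC' hC'e => federbush_strict_min hq hq1 hV hW hCt hC hCe h0 hWV hC' hC'e, hpol⟩

end Summit.QuantumFields.BalabanUV.Beta.GAN24.DerivativeRateTransferJensenMassFreeFederbush

end
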